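import Summits.AtomisticToContinuum.Crystallization.Theorems.FrustratedLawDichotomyTextureUnpacking
import Summits.AtomisticToContinuum.Crystallization.Theorems.FrustratedLawDichotomyNashAtLocalLimits
import Summits.AtomisticToContinuum.Crystallization.Theorems.GscTwinLoopSurgeryLocalLimitStableField
import Literature.MathematicalPhysics.StatisticalMechanics.LocalMatchingCompactness
import Literature.Probability.Process.PointStationaryLaw

/-!
# `NetworkRecurrenceTransfer.stub_recurrentMember` — part 2/4: the route's predicates as definitions, dictionary, re-rooting

Registered stub `stub_recurrentMember` of `NetworkRecurrenceTransfer` (RED, `stmt-AtomisticToContinuum-27236`,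
route `RepetitiveNetworkReduction`, sub-problem `Crystallization` of `AtomisticToContinuum`); file of record written by
the decomp-a2c cell's lens-2 g17 seat (v2, sha256 f8100bfc…, 1163 lines, one namespace), SPLIT VERBATIM into four
modules ≤ 400 lines for the tree's file-size lint by hand-1 g5 (declarations, statements and proofs byte-identical;
only imports / module docstrings differ):
* `RepetitiveNetworkReductionRecurrentMemberEngine` — matching calculus + the hull engine `exists_mem_uniformlyRecurrent`;
* `RepetitiveNetworkReductionRecurrentMemberDefs` — the route's `let`s as definitions, the counting-measure dictionary,
  re-rooting invariance of the good class;
* `RepetitiveNetworkReductionRecurrentMemberLimits` — far tails, convergence of field sums, closure of `Appr` / Nash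
  under rooted local limits;
* `RepetitiveNetworkReductionRecurrentMember` — closure of `IsMuGSC`, `goodClass_closed`, assembly and the stub BY NAME.

This part: the route's `let`s `Gy`, `TexBall`, `Appr`, `NashM`, `e⋆`, `MuG`, `UR` as definitions (bodies verbatim),
their set-level versions `ApprS` / `NashS` and the class `goodClass δ R₇ R₈ R₉` fed to the hull engine; the
counting-measure dictionary (`apprM_iff`, `nashM_iff`, `muGM_iff`, via
`Literature.Probability.Process.count_restrict_singleton_ne_zero_iff`); invariance of the class under re-rooting
`Z ↦ Z − z`, `z ∈ Z` (`goodClass_image_sub`; the μGSC inequality is transported along `x ↦ x + z` with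
`interactionEnergy_add_const` of `Literature.MathematicalPhysics.StatisticalMechanics.LennardJonesClusters`). All `[folklore]`.
-/


noncomputable section

open scoped BigOperators Topology
open Filter Set Metric MeasureTheory

namespace Summit.AtomisticToContinuum.Crystallization.Theorems.RepetitiveNetworkReductionRecurrentMember

open Literature.MathematicalPhysics.StatisticalMechanics
open Literature.Probability.Process (count_restrict_singleton_ne_zero_iff)

/-! ## The route's predicates, as definitions (bodies verbatim the registered `let`s) -/

/-- `Gy η N y j`: particle `j` of the finite configuration `y` has an `η`-good (fcc- or hcp-like) first shell
(verbatim the route's `let Gy`). [folklore] -/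
def Gy (η : ℝ) (N : ℕ) (y : Fin N → EuclideanSpace ℝ (Fin 3)) (j : Fin N) : Prop :=
  let d : ℝ := sInf ((fun z => dist z (y (j : Fin N))) '' (Set.range (y) \ {(y (j : Fin N))})); let T : Set (EuclideanSpace ℝ (Fin 3)) := {z : EuclideanSpace ℝ (Fin 3) | z ∈ Set.range (y) ∧ z ≠ (y (j : Fin N)) ∧ dist z (y (j : Fin N)) < 13 / 10 * d}; ∃ A : EuclideanSpace ℝ (Fin 3) →ₗᵢ[ℝ] EuclideanSpace ℝ (Fin 3), (∃ e : ↥T ≃ ↥Literature.Geometry.DiscreteGeometry.fccKissingPattern, ∀ t : ↥T, dist (d⁻¹ • ((t : EuclideanSpace ℝ (Fin 3)) - (y (j : Fin N)))) (A ((e t : ↥Literature.Geometry.DiscreteGeometry.fccKissingPattern) : EuclideanSpace ℝ (Fin 3))) ≤ η) ∨ (∃ e : ↥T ≃ ↥Literature.Geometry.DiscreteGeometry.hcpKissingPattern, ∀ t : ↥T, dist (d⁻¹ • ((t : EuclideanSpace ℝ (Fin 3)) - (y (j : Fin N)))) (A ((e t : ↥Literature.Geometry.DiscreteGeometry.hcpKissingPattern)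 : EuclideanSpace ℝ (Fin 3))) ≤ η)

/-- `TexBall N y i R R₇ R₈ R₉`: the `R`-ball of the finite configuration `y` about particle `i` is TCP-textured
(verbatim the route's `let TexBall`, over `Gy`). [folklore] -/
def TexBall (N : ℕ) (y : Fin N → EuclideanSpace ℝ (Fin 3)) (i : Fin N) (R R₇ R₈ R₉ : ℝ) : Prop :=
  (∀ a b : Fin N, a ≠ b → (7 : ℝ) / 10 ≤ dist (y a) (y b)) ∧ (∀ j : Fin N, dist (y j) (y i) ≤ R → ¬ Gy (1 / 20) N (y) j) ∧ (∀ j : Fin N, dist (y j) (y i) ≤ R → ¬ ((∀ j' : Fin N, dist (y j') (y j) ≤ R₇ → ¬ Gy (1 / 20) N (y) j') ∧ (∀ z : EuclideanSpace ℝ (Fin 3), dist z (y j) ≤ R₇ → ∃ k : Fin N, dist z (y k) ≤ 1) ∧ (∀ j' : Fin N, dist (y j') (y j) ≤ R₇ → (let d : ℝ := sInf ((fun z => dist z (y j')) '' (Set.range (y) \ {(y j')})); ∀ k : Fin N, y k ≠ y j' → dist (y k) (y j') < 27 / 20 * d → 5 ≤ Nat.card {m : Fin N // y m ≠ y j' ∧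 dist (y m) (y j') < 27 / 20 * d ∧ y m ≠ y k ∧ dist (y m) (y k) < 27 / 20 * d})))) ∧ (∀ j : Fin N, dist (y j) (y i) ≤ R → ∃ k : Fin N, dist (y k) (y j) ≤ R₈ ∧ Gy (1 / 8) N (y) k) ∧ (∀ j : Fin N, dist (y j) (y i) ≤ R → ¬ ((∀ j' : Fin N, dist (y j') (y j) ≤ R₉ → ¬ Gy (1 / 20) N (y) j') ∧ (Nat.card {j' : Fin N // dist (y j') (y j) ≤ R₉ ∧ ¬ Gy (1 / 8) N (y) j'} : ℝ) ≤ 1 / 2 * (Nat.card {j' : Fin N // dist (y j') (y j) ≤ R₉} : ℝ) ∧ (∀ j' : Fin N, dist (y j') (y j) ≤ R₉ → ¬ Gy (1 / 8) N (y) j' → ¬ (let d : ℝ := sInf ((fun z => dist z (y j')) '' (Set.range (y) \ {(y j')})); ∀ k : Fin N, y k ≠ y j' → dist (y k) (y j') < 27 / 20 * d → 5 ≤ Nat.card {m : Fin N // y m ≠ y j' ∧ dist (y m) (y j') < 27 / 20 * d ∧ y m ≠ y k ∧ dist (y m) (y k) < 27 / 20 * d}))))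

/-- `ApprM μ R₇ R₈ R₉`: about every atom the configuration `μ` is two-way matched, at every radius and tolerance, by
TCP-textured balls (verbatim the route's `let Appr`). [folklore] -/
def ApprM (μ : Measure (EuclideanSpace ℝ (Fin 3))) (R₇ R₈ R₉ : ℝ) : Prop :=
  ∀ q : EuclideanSpace ℝ (Fin 3), μ {q} ≠ 0 → ∀ R ε : ℝ, 0 < ε → ∃ (N : ℕ) (y : Fin N → EuclideanSpace ℝ (Fin 3)) (i : Fin N), TexBall N y i R R₇ R₈ R₉ ∧ (∀ p : EuclideanSpace ℝ (Fin 3), μ {p} ≠ 0 → dist p q ≤ R → ∃ k : Fin N, dist (y k - y i) (p - q) ≤ ε) ∧ (∀ k : Fin N, dist (y k) (y i) ≤ R → ∃ p : EuclideanSpace ℝ (Fin 3), μ {p} ≠ 0 ∧ dist (y k - y i) (p - q) ≤ ε)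

/-- `NashM μ`: no atom of `μ` lowers its Lennard-Jones field energy by moving to a position avoiding the other atoms
(verbatim the route's `let NashM`). [folklore] -/
def NashM (μ : Measure (EuclideanSpace ℝ (Fin 3))) : Prop :=
  ∀ p : EuclideanSpace ℝ (Fin 3), μ {p} ≠ 0 → ∀ y : EuclideanSpace ℝ (Fin 3), (∀ q : EuclideanSpace ℝ (Fin 3), μ {q} ≠ 0 → q ≠ p → y ≠ q) → ∑' q : {q : EuclideanSpace ℝ (Fin 3) // μ {q} ≠ 0 ∧ q ≠ p}, lennardJones (dist p (q : EuclideanSpace ℝ (Fin 3))) ≤ ∑' q : {q : EuclideanSpace ℝ (Fin 3) // μ {q} ≠ 0 ∧ q ≠ p}, lennardJones (dist y (q : EuclideanSpace ℝ (Fin 3)))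

/-- `e⋆ = inf_Q e(Q)`: the optimal Lennard-Jones energy per particle over periodic configurations. [folklore] -/
def eStar : ℝ := ⨅ Q : PeriodicConfiguration 3, Q.energyPerParticle lennardJones

/-- `MuGM μ`: the atoms of `μ` form a `μ`-ground-state configuration at chemical potential `e⋆` (the route's `let MuG`
is `IsMuGSC lennardJones e⋆ {atoms}` unfolded). [folklore] -/
def MuGM (μ : Measure (EuclideanSpace ℝ (Fin 3))) : Prop :=
  IsMuGSC lennardJones eStar {p : EuclideanSpace ℝ (Fin 3) | μ {p} ≠ 0}

/-- `URS S`: rooted uniform recurrence of the point set `S` (verbatim the route's `let UR`). [folklore] -/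
def URS (S : Set (EuclideanSpace ℝ (Fin 3))) : Prop :=
  ∀ R ε : ℝ, 0 < ε → ∃ G : ℝ, ∀ w ∈ S, ∃ g ∈ S, dist g w ≤ G ∧ (∀ s ∈ S, dist s (0 : EuclideanSpace ℝ (Fin 3)) ≤ R → ∃ a ∈ S, dist (a - g) s ≤ ε) ∧ (∀ a ∈ S, dist (a - g) (0 : EuclideanSpace ℝ (Fin 3)) ≤ R → ∃ s ∈ S, dist (a - g) s ≤ ε)

/-! ## Set-level versions -/

/-- Set-level `Appr`: `ApprM` with "atom of `count|Z`" replaced by "point of `Z`". [folklore] -/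
def ApprS (Z : Set (EuclideanSpace ℝ (Fin 3))) (R₇ R₈ R₉ : ℝ) : Prop :=
  ∀ q ∈ Z, ∀ R ε : ℝ, 0 < ε → ∃ (N : ℕ) (y : Fin N → EuclideanSpace ℝ (Fin 3)) (i : Fin N),
    TexBall N y i R R₇ R₈ R₉ ∧ (∀ p ∈ Z, dist p q ≤ R → ∃ k : Fin N, dist (y k - y i) (p - q) ≤ ε) ∧
      (∀ k : Fin N, dist (y k) (y i) ≤ R → ∃ p ∈ Z, dist (y k - y i) (p - q) ≤ ε)

/-- Set-level `Nash`. [folklore] -/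
def NashS (Z : Set (EuclideanSpace ℝ (Fin 3))) : Prop :=
  ∀ p ∈ Z, ∀ y : EuclideanSpace ℝ (Fin 3), (∀ q ∈ Z, q ≠ p → y ≠ q) →
    ∑' q : ↥(Z \ {p}), lennardJones (dist p (q : EuclideanSpace ℝ (Fin 3))) ≤
      ∑' q : ↥(Z \ {p}), lennardJones (dist y (q : EuclideanSpace ℝ (Fin 3)))

/-- The class fed to the hull engine: rooted `δ`-separated point sets with the three closed properties. [folklore] -/
def goodClass (δ R₇ R₈ R₉ : ℝ) : Set (Set (EuclideanSpace ℝ (Fin 3))) :=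
  {Z | (0 : EuclideanSpace ℝ (Fin 3)) ∈ Z ∧ (∀ p ∈ Z, ∀ q ∈ Z, p ≠ q → δ ≤ dist p q) ∧
    ApprS Z R₇ R₈ R₉ ∧ NashS Z ∧ IsMuGSC lennardJones eStar Z}

/-! ## Counting-measure dictionary -/

/-- Changing the index predicate of a subtype sum along a pointwise equivalence. [folklore] -/
theorem tsum_subtype_congr_prop {P Q : EuclideanSpace ℝ (Fin 3) → Prop} (h : ∀ x, P x ↔ Q x)
    (f : EuclideanSpace ℝ (Fin 3) → ℝ) :
    ∑' x : {x // P x}, f x = ∑' x : {x // Q x}, f x := by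
  have hPQ : P = Q := funext fun x => propext (h x)
  subst hPQ
  rfl

/-- `ApprM (count|Z) ↔ ApprS Z`. [folklore] -/
theorem apprM_iff (Z : Set (EuclideanSpace ℝ (Fin 3))) (R₇ R₈ R₉ : ℝ) :
    ApprM ((Measure.count : Measure (EuclideanSpace ℝ (Fin 3))).restrict Z) R₇ R₈ R₉ ↔ ApprS Z R₇ R₈ R₉ := by
  simp only [ApprM, ApprS, count_restrict_singleton_ne_zero_iff]

/-- `NashM (count|Z) ↔ NashS Z`. [folklore] -/
theorem nashM_iff (Z : Set (EuclideanSpace ℝ (Fin 3))) :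
    NashM ((Measure.count : Measure (EuclideanSpace ℝ (Fin 3))).restrict Z) ↔ NashS Z := by
  have key : ∀ (p : EuclideanSpace ℝ (Fin 3)) (f : EuclideanSpace ℝ (Fin 3) → ℝ),
      ∑' q : {q : EuclideanSpace ℝ (Fin 3) // (Measure.count : Measure (EuclideanSpace ℝ (Fin 3))).restrict Z {q} ≠ 0 ∧ q ≠ p}, f q =
        ∑' q : ↥(Z \ {p}), f q := by
    intro p f
    exact tsum_subtype_congr_prop (fun x => by rw [count_restrict_singleton_ne_zero_iff, Set.mem_sdiff, Set.mem_singleton_iff]) f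
  simp only [NashM, NashS, count_restrict_singleton_ne_zero_iff]
  constructor
  · intro h p hp y hy
    have h1 := h p hp y hy
    rw [key p (fun q => lennardJones (dist p q)), key p (fun q => lennardJones (dist y q))] at h1
    exact h1
  · intro h p hp y hy
    have h1 := h p hp y hy
    rw [key p (fun q => lennardJones (dist p q)), key p (fun q => lennardJones (dist y q))]
    exact h1

/-- `MuGM (count|Z) ↔ IsMuGSC lennardJones e⋆ Z`. [folklore] -/
theorem muGM_iff (Z : Set (EuclideanSpace ℝ (Fin 3))) :
    MuGM ((Measure.count : Measure (EuclideanSpace ℝ (Fin 3))).restrict Z) ↔ IsMuGSC lennardJones eStar Z := by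
  have hZ : {p : EuclideanSpace ℝ (Fin 3) | (Measure.count : Measure (EuclideanSpace ℝ (Fin 3))).restrict Z {p} ≠ 0} = Z :=
    Set.ext fun p => count_restrict_singleton_ne_zero_iff Z p
  rw [MuGM, hZ]

/-! ## Re-rooting -/

/-- Re-rooting preserves `ApprS` (the matching data are differences). [folklore] -/
theorem apprS_image_sub {Z : Set (EuclideanSpace ℝ (Fin 3))} {R₇ R₈ R₉ : ℝ} (h : ApprS Z R₇ R₈ R₉)
    (z : EuclideanSpace ℝ (Fin 3)) : ApprS ((fun p => p - z) '' Z) R₇ R₈ R₉ := by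
  rintro _ ⟨q, hq, rfl⟩ R ε hε
  obtain ⟨N, y, i, hT, h1, h2⟩ := h q hq R ε hε
  refine ⟨N, y, i, hT, ?_, fun k hk => ?_⟩
  · rintro _ ⟨p, hp, rfl⟩ hpq
    rw [dist_sub_right] at hpq
    obtain ⟨k, hk⟩ := h1 p hp hpq
    exact ⟨k, by rwa [sub_sub_sub_cancel_right]⟩
  · obtain ⟨p, hp, hkp⟩ := h2 k hk
    exact ⟨p - z, ⟨p, hp, rfl⟩, by rwa [sub_sub_sub_cancel_right]⟩

/-- The other points of `Z - z`, seen from `p - z`, are the other points of `Z` seen from `p`, translated. [folklore] -/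
def diffEquiv (Z : Set (EuclideanSpace ℝ (Fin 3))) (z p : EuclideanSpace ℝ (Fin 3)) :
    ↥(Z \ {p}) ≃ ↥(((fun p => p - z) '' Z) \ {p - z}) where
  toFun q := ⟨(q : EuclideanSpace ℝ (Fin 3)) - z, ⟨(q : EuclideanSpace ℝ (Fin 3)), q.2.1, rfl⟩, fun h => q.2.2 (by
      have h' : (q : EuclideanSpace ℝ (Fin 3)) - z = p - z := h
      exact sub_left_injective h')⟩
  invFun q := ⟨(q : EuclideanSpace ℝ (Fin 3)) + z, (by obtain ⟨p', hp', hp'w⟩ := q.2.1; have e' : p' - z = _ := hp'w; rw [← e', sub_add_cancel]; exact hp'), fun h => q.2.2 (by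
      have h' : (q : EuclideanSpace ℝ (Fin 3)) + z = p := h
      exact eq_sub_of_add_eq h')⟩
  left_inv q := by
    ext1
    simp
  right_inv q := by
    ext1
    simp

/-- Re-rooting preserves `NashS`. [folklore] -/
theorem nashS_image_sub {Z : Set (EuclideanSpace ℝ (Fin 3))} (h : NashS Z) (z : EuclideanSpace ℝ (Fin 3)) :
    NashS ((fun p => p - z) '' Z) := by
  rintro _ ⟨p, hp, rfl⟩ y hy
  have hy' : ∀ q ∈ Z, q ≠ p → y + z ≠ q := by
    intro q hq hqp hyq
    refine hy (q - z) ⟨q, hq, rfl⟩ (fun h => hqp (sub_left_injective h)) ?_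
    rw [← hyq, add_sub_cancel_right]
  have h1 := h p hp (y + z) hy'
  rw [← Equiv.tsum_eq (diffEquiv Z z p) (fun q => lennardJones (dist (p - z) (q : EuclideanSpace ℝ (Fin 3)))),
    ← Equiv.tsum_eq (diffEquiv Z z p) (fun q => lennardJones (dist y (q : EuclideanSpace ℝ (Fin 3))))]
  have hl : ∑' c : ↥(Z \ {p}), lennardJones (dist (p - z) ((diffEquiv Z z p c : ↥(((fun p => p - z) '' Z) \ {p - z})) : EuclideanSpace ℝ (Fin 3))) =
      ∑' c : ↥(Z \ {p}), lennardJones (dist p (c : EuclideanSpace ℝ (Fin 3))) := by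
    refine tsum_congr fun c => ?_
    show lennardJones (dist (p - z) ((c : EuclideanSpace ℝ (Fin 3)) - z)) = _
    rw [dist_sub_right]
  have hr : ∑' c : ↥(Z \ {p}), lennardJones (dist y ((diffEquiv Z z p c : ↥(((fun p => p - z) '' Z) \ {p - z})) : EuclideanSpace ℝ (Fin 3))) =
      ∑' c : ↥(Z \ {p}), lennardJones (dist (y + z) (c : EuclideanSpace ℝ (Fin 3))) := by
    refine tsum_congr fun c => ?_
    show lennardJones (dist y ((c : EuclideanSpace ℝ (Fin 3)) - z)) = _
    rw [← dist_sub_right (y + z) (c : EuclideanSpace ℝ (Fin 3)) z, add_sub_cancel_right]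
  rw [hl, hr]
  exact h1

/-- The points of `Z` off a translated finite part, and the points of `Z - z` off the finite part. [folklore] -/
def restEquiv (Z : Set (EuclideanSpace ℝ (Fin 3))) (z : EuclideanSpace ℝ (Fin 3)) {n : ℕ}
    (xf : Fin n → EuclideanSpace ℝ (Fin 3)) :
    ↥(Z \ Set.range (fun i => xf i + z)) ≃ ↥(((fun p => p - z) '' Z) \ Set.range xf) where
  toFun q := ⟨(q : EuclideanSpace ℝ (Fin 3)) - z, ⟨(q : EuclideanSpace ℝ (Fin 3)), q.2.1, rfl⟩, by
      rintro ⟨i, hi⟩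
      refine q.2.2 ⟨i, ?_⟩
      show xf i + z = (q : EuclideanSpace ℝ (Fin 3))
      rw [hi, sub_add_cancel]⟩
  invFun q := ⟨(q : EuclideanSpace ℝ (Fin 3)) + z, (by obtain ⟨p', hp', hp'w⟩ := q.2.1; have e' : p' - z = _ := hp'w; rw [← e', sub_add_cancel]; exact hp'), by
      rintro ⟨i, hi⟩
      exact q.2.2 ⟨i, add_left_injective z hi⟩⟩
  left_inv q := by
    ext1
    simp
  right_inv q := by
    ext1
    simp

/-- Re-rooting preserves `IsMuGSC` for a separated set (summability from separation; the replacement test is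
translated back). [folklore] -/
theorem isMuGSC_image_sub {Z : Set (EuclideanSpace ℝ (Fin 3))} {δ : ℝ} (hδ : 0 < δ)
    (hsep : ∀ p ∈ Z, ∀ q ∈ Z, p ≠ q → δ ≤ dist p q) (h : IsMuGSC lennardJones eStar Z)
    (z : EuclideanSpace ℝ (Fin 3)) : IsMuGSC lennardJones eStar ((fun p => p - z) '' Z) := by
  refine ⟨fun r => UniformlyDiscrete.summable_lennardJones_dist ⟨δ, hδ, (by
      rintro _ ⟨p, hp, rfl⟩ _ ⟨q, hq, rfl⟩ hne
      rw [dist_sub_right]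
      exact hsep p hp q hq fun h => hne (by rw [h]))⟩ r, ?_⟩
  intro n xf hxf hxfW k R hR hdisj
  -- translate back
  have hxf' : Function.Injective (fun i => xf i + z) := fun i j hij => hxf (add_left_injective z hij)
  have hR' : Function.Injective (fun i => R i + z) := fun i j hij => hR (add_left_injective z hij)
  have hxfZ : Set.range (fun i => xf i + z) ⊆ Z := by
    rintro _ ⟨i, rfl⟩
    obtain ⟨p', hp', hp'w⟩ := hxfW ⟨i, rfl⟩
    have e' : p' - z = xf i := hp'w
    show xf i + z ∈ Z
    rw [← e', sub_add_cancel]; exact hp'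
  have hdisj' : Disjoint (Set.range (fun i => R i + z)) (Z \ Set.range (fun i => xf i + z)) := by
    rw [Set.disjoint_left]
    rintro _ ⟨j, rfl⟩ hmem
    refine (Set.disjoint_left.1 hdisj) (Set.mem_range_self j) ⟨⟨R j + z, hmem.1, add_sub_cancel_right _ _⟩, ?_⟩
    rintro ⟨i, hi⟩
    refine hmem.2 ⟨i, ?_⟩
    show xf i + z = R j + z
    rw [hi]
  have key := h.2 n (fun i => xf i + z) hxf' hxfZ k (fun i => R i + z) hR' hdisj'
  rw [interactionEnergy_add_const, interactionEnergy_add_const] at key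
  have hfield : ∀ w : EuclideanSpace ℝ (Fin 3),
      ∑' y : ↥(Z \ Set.range (fun i => xf i + z)), lennardJones (dist (w + z) (y : EuclideanSpace ℝ (Fin 3))) =
        ∑' y : ↥(((fun p => p - z) '' Z) \ Set.range xf), lennardJones (dist w (y : EuclideanSpace ℝ (Fin 3))) := by
    intro w
    rw [← Equiv.tsum_eq (restEquiv Z z xf)]
    refine tsum_congr fun y => ?_
    show lennardJones (dist (w + z) (y : EuclideanSpace ℝ (Fin 3))) = lennardJones (dist w ((y : EuclideanSpace ℝ (Fin 3)) - z))
    rw [← dist_sub_right (w + z) (y : EuclideanSpace ℝ (Fin 3)) z, add_sub_cancel_right]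
  simp only [hfield] at key
  exact key

/-- Re-rooting at a point keeps the class. [folklore] -/
theorem goodClass_image_sub {δ R₇ R₈ R₉ : ℝ} (hδ : 0 < δ) {Z : Set (EuclideanSpace ℝ (Fin 3))}
    (hZ : Z ∈ goodClass δ R₇ R₈ R₉) {z : EuclideanSpace ℝ (Fin 3)} (hz : z ∈ Z) :
    (fun p => p - z) '' Z ∈ goodClass δ R₇ R₈ R₉ := by
  obtain ⟨h0, hsep, hA, hN, hM⟩ := hZ
  exact ⟨⟨z, hz, sub_self z⟩, (by
      rintro _ ⟨p, hp, rfl⟩ _ ⟨q, hq, rfl⟩ hne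
      rw [dist_sub_right]
      exact hsep p hp q hq fun h => hne (by rw [h])), apprS_image_sub hA z, nashS_image_sub hN z,
    isMuGSC_image_sub hδ hsep hM z⟩

/-! ## Fields of separated configurations along two-way matched sequences (infinite approximants) -/

open Summit.AtomisticToContinuum.Crystallization.Theorems.LocalLimitStable
  (tendsto_sum_lennardJones_of_matched exists_pos_le_dist_of_not_mem sum_abs_lennardJones_le_of_far)


end Summit.AtomisticToContinuum.Crystallization.Theorems.RepetitiveNetworkReductionRecurrentMember
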